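import Summits.KontsevichZagierPeriods.KontsevichZagierPeriods.Theorems.HurwitzMicroSectorsNormalFormPrincipleDilogExistsBoxAtoms
import Literature.NumberTheory.Transcendental.KZProductIdeal

/-!
# `NormalFormPrinciple` (stmt-KontsevichZagierPeriods-3869), line `SketchIdeator1` —
# leaf `stub_boxRigidity`, layer `M3` (WeightDropTornheim): the base triangle is the `ζ(2)` simplex

Pure proof file (registered sub-goal `wdt_tau_sub_simplex` of the layer `M3`, lead seat c9;
`--supports` the crux). In the move chain for the Tornheim weight drop
`[(0,1)³, 1/((1 − xy)(1 − xz))] ∼ [(0,1)², 2/(1 − xy)]`, the Newton–Leibniz move lands on the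
triangle representation `T = [{0 < y₀ < y₁ < 1}, 1/(y₁(1 − y₀))]`, which is the `ζ(2)` simplex
`S = [{0 < t₁ < t₀ < 1}, 1/(t₀(1 − t₁))]` read through the coordinate swap `(y₀, y₁) = (t₁, t₀)`.

This file proves:
1. for any two representations with literally these domains and integrands agreeing with the
   displayed functions on them, `[T] − [S] ∈ KZ.relations`: one rule-(2) move, the coordinate
   permutation `KZ.of_sub_of_reindex_mem_relations S (Equiv.swap 0 1)` (`[S] − [S ∘ swap]`),
   followed by congruence of integrands on the common domain
   (`KZ.of_sub_of_mem_relations_of_eqOn`, rule (1b) with a zero representation);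
2. given such an `S`, such a `T` exists: `T := S.reindex (Equiv.swap 0 1)`.

References: M. Kontsevich, D. Zagier, *Periods* (2001), §1.1–1.2, rules (1), (2). No definitions
are introduced.
-/

noncomputable section

open MeasureTheory Set
open Literature.NumberTheory.Transcendental Literature.NumberTheory.Transcendental.KZ
open Literature.ModelTheory.ExponentialFields (IsSemialgebraic)

namespace Summit.KontsevichZagierPeriods.HurwitzMicroSectors.NormalFormPrinciple.PiBox.M3

/-! ## The swapped simplex -/

/-- The domain of the `ζ(2)` simplex `{0 < t₁ < t₀ < 1}` reindexed along `Equiv.swap 0 1` is the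
triangle `{0 < y₀ < y₁ < 1}`. [folklore] -/
theorem wdt4_reindex_swap_domain (S : IntegralRep 2)
    (hSd : S.domain = {t | 0 < t 1 ∧ t 1 < t 0 ∧ t 0 < 1}) :
    (S.reindex (Equiv.swap (0 : Fin 2) 1)).domain = {y | 0 < y 0 ∧ y 0 < y 1 ∧ y 1 < 1} := by
  ext w
  simp only [IntegralRep.reindex_domain, hSd, mem_setOf_eq, Equiv.swap_apply_left,
    Equiv.swap_apply_right]

/-- The integrand of the `ζ(2)` simplex reindexed along `Equiv.swap 0 1` agrees with
`y ↦ 1/(y₁(1 − y₀))` on its domain. [folklore] -/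
theorem wdt4_reindex_swap_integrand (S : IntegralRep 2)
    (hSi : EqOn S.integrand (fun t => 1 / (t 0 * (1 - t 1))) S.domain) :
    EqOn (S.reindex (Equiv.swap (0 : Fin 2) 1)).integrand (fun y => 1 / (y 1 * (1 - y 0)))
      (S.reindex (Equiv.swap (0 : Fin 2) 1)).domain := by
  intro w hw
  have hw' : (fun i => w (Equiv.swap (0 : Fin 2) 1 i)) ∈ S.domain := by
    rw [IntegralRep.reindex_domain] at hw
    exact hw
  rw [IntegralRep.reindex_integrand]
  show S.integrand (fun i => w (Equiv.swap (0 : Fin 2) 1 i)) = 1 / (w 1 * (1 - w 0))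
  rw [hSi hw']
  simp only [Equiv.swap_apply_left, Equiv.swap_apply_right]

/-! ## The registered sub-goal -/

/-- **Stub T3b (`wdt_tau_sub_simplex`; registered sub-goal of stmt-KontsevichZagierPeriods-3869,
line `SketchIdeator1`, layer `M3`).** The base triangle of the Tornheim weight-drop chain,
`T = [{0 < y₀ < y₁ < 1}, 1/(y₁(1 − y₀))]`, is the `ζ(2)` simplex
`S = [{0 < t₁ < t₀ < 1}, 1/(t₀(1 − t₁))]` read through the coordinate swap:
(1) for any representations with literally these domains and integrands agreeing with the
displayed functions on them, `[T] − [S] ∈ KZ.relations` (the permutation move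
`[S] − [S ∘ swap]`, rule (2), then congruence of integrands, rule (1));
(2) given such an `S`, such a `T` exists (`S` reindexed along the swap).
[cite: KontsevichZagier2001, §1.2 rule (2)] -/
theorem wdt_tau_sub_simplex :
    (∀ (T S : IntegralRep 2),
      T.domain = {y | 0 < y 0 ∧ y 0 < y 1 ∧ y 1 < 1} →
      EqOn T.integrand (fun y => 1 / (y 1 * (1 - y 0))) T.domain →
      S.domain = {t | 0 < t 1 ∧ t 1 < t 0 ∧ t 0 < 1} →
      EqOn S.integrand (fun t => 1 / (t 0 * (1 - t 1))) S.domain →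
      of T - of S ∈ relations) ∧
    (∀ (S : IntegralRep 2),
      S.domain = {t | 0 < t 1 ∧ t 1 < t 0 ∧ t 0 < 1} →
      EqOn S.integrand (fun t => 1 / (t 0 * (1 - t 1))) S.domain →
      ∃ T : IntegralRep 2, T.domain = {y | 0 < y 0 ∧ y 0 < y 1 ∧ y 1 < 1} ∧
        EqOn T.integrand (fun y => 1 / (y 1 * (1 - y 0))) T.domain) := by
  refine ⟨fun T S hTd hTi hSd hSi => ?_, fun S hSd hSi =>
    ⟨S.reindex (Equiv.swap (0 : Fin 2) 1), wdt4_reindex_swap_domain S hSd,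
      wdt4_reindex_swap_integrand S hSi⟩⟩
  -- move 1 (rule 2): `[S] − [S ∘ swap]`
  have h1 : of S - of (S.reindex (Equiv.swap (0 : Fin 2) 1)) ∈ relations :=
    of_sub_of_reindex_mem_relations S (Equiv.swap (0 : Fin 2) 1)
  have hd : (S.reindex (Equiv.swap (0 : Fin 2) 1)).domain = {y | 0 < y 0 ∧ y 0 < y 1 ∧ y 1 < 1} :=
    wdt4_reindex_swap_domain S hSd
  -- move 2 (rule 1): congruence of `T` and `S ∘ swap` on the common triangle
  have h2 : of T - of (S.reindex (Equiv.swap (0 : Fin 2) 1)) ∈ relations := by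
    refine of_sub_of_mem_relations_of_eqOn (hd.trans hTd.symm) fun w hw => ?_
    have hw' : w ∈ (S.reindex (Equiv.swap (0 : Fin 2) 1)).domain := by
      rw [hd]
      rw [hTd] at hw
      exact hw
    exact (hTi hw).trans (wdt4_reindex_swap_integrand S hSi hw').symm
  -- bookkeeping
  have e : of T - of S = (of T - of (S.reindex (Equiv.swap (0 : Fin 2) 1))) -
      (of S - of (S.reindex (Equiv.swap (0 : Fin 2) 1))) := by
    abel
  rw [e]
  exact relations.sub_mem h2 h1

end Summit.KontsevichZagierPeriods.HurwitzMicroSectors.NormalFormPrinciple.PiBox.M3
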